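import Summits.FinalStateConjecture.FinalStateConjecture.Theses.TemporalBandLiouville
import HarnessLib.Audit

/-!
# Birth skeleton (BC3) for crux `TemporalBandLiouville.StationaryHarmonicExteriorIsKerr` (stmt-FinalStateConjecture-18040)

Piece P2 of the typed decomposition (BC2 redirect) of `TemporalBandLiouville.StationaryLimitReduction`
(item 10173), filed by the crux-strategist seat planner-cstrat-stmt-FinalStateConjecture-10173-r1-0, 2026-08-17.

## The crux (FIXED, by name)

P2 = SMOOTH NO-HAIR IN X'S OWN PRESENTATION: for all `a`, `r₀ > 0` and metric components `G` in X's class (the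
seven-clause antecedent of `EternalExteriorStationary`, verbatim: smooth symmetric invertible `G` on the excised
cylinder `Kerr.region a r₀`, slices uniformly spacelike, excision collar with `dr` timelike and inflow, `Ric = 0`,
harmonic gauge, all `C^k` norms of `G` and `G⁻¹` bounded, stationary-rate fall-off to `η`) which is `t`-INDEPENDENT on
the cylinder, there are `0 < M'`, `|a'| ≤ M'` and a smooth injective `Ψ` on the cylinder into `{Kerr.radius a' > 0}`
with `G x (v, w) = Kerr.bilin M' a' (Ψ x) (DΨ_x v) (DΨ_x w)`: the cylinder is an isometrically embedded piece of an
ingoing Kerr–Schild Kerr spacetime.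

## The cut — HAWKING RIGIDITY WITHOUT ANALYTICITY + AXISYMMETRIC UNIQUENESS (the classical two-step, typed)

* S1 `stub_secondKilling` (HARDEST; open away from Kerr) — "stationary ⇒ axisymmetric" for the smooth class: a
  `t`-independent member of X's class carries a SECOND coordinate Killing field `K` on the cylinder — smooth,
  invariant under the chart's time translation (`K (x + s e₀) = K x`, i.e. `[∂ₜ, K] = 0`), Killing for `G`
  (coordinate Killing equation `D_K G (v,w) + G (D_v K, w) + G (v, D_w K) = 0`), and not a constant multiple of
  `e₀ = ∂ₜ`. Content: Hawking's local rigidity at the event horizon needs analyticity (Hawking–Ellis 9.3.6,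
  Chruściel 1996, Friedrich–Rácz–Wald) or near-Kerr smallness (Alexakis–Ionescu–Klainerman: Carleman estimates +
  `T`-conditional pseudo-convexity, extension of the Hawking field across the ergoregion); the harmonic
  horizon-penetrating chart with uniformly spacelike slices does NOT supply analyticity in the ergoregion (the
  reduced harmonic-gauge operator `g^{ij}∂ᵢ∂ⱼ` on `t`-independent fields is elliptic iff `∂ₜ` is timelike,
  Müller zum Hagen 1970), so this stub is the Ionescu–Klainerman frontier. For Kerr pieces `K` is the push-forward
  of `∂_φ` (which commutes with the chart's `∂ₜ`: the latter is asymptotically the unit time translation by the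
  fall-off clause, hence `∂_T` (+ nothing growing), and Kerr's Killing algebra is abelian).
* S2 `stub_axisymmetricUniqueness` (known on paper for this class, XL in Lean) — given such a second Killing field,
  the cylinder is an embedded Kerr piece: AF Killing-field structure (Beig–Chruściel: with `M_ADM ≠ 0` a second
  Killing field commuting with the stationary one is an axial rotation with closed orbits and an axis),
  Carter–Robinson–Mazur–Bunting–Weinstein uniqueness of the Ernst reduction on the d.o.c. (one connected horizon:
  the excised region is one spheroid; non-degenerate: Chruściel–Costa 2008; degenerate: Chruściel–Nguyen 2010,
  Figueras–Lucietti), positive mass with horizon boundary for `0 < M'`, and continuation of the isometry across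
  `𝓗⁺` into the collar (Fuchsian uniqueness for the interior Ernst system with regular horizon data, Ansorg–Hennig
  2009). The inflow collar forces a black-hole region (Minkowski / negative mass / super-extremal presentations
  are excluded), so `0 < M'`; extremal `|a'| = M'` is allowed by the conclusion although the collar excludes it.

Composition `StationaryHarmonicExteriorIsKerr_of : Sig.stub_secondKilling → Sig.stub_axisymmetricUniqueness →
StationaryHarmonicExteriorIsKerr` (kernel-checked, no `sorry` of its own): chain S1 into S2. The registered stub
signatures are DEF-FREE (expanded over the Lorentz prelude only), so stub proofs can land as `Theorems/…` files.

## Disproof used / negatives / barriers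

No `Disproof.lean` exists for this (new) item. `ledger negatives --problem FinalStateConjecture` (2026-08-17): one
entry (`not_UniformPhotonSphereChannels`), unrelated. Barriers honoured: `IonescuKlainermanNonExtension` bites S1
EXACTLY (no local Killing extension across `𝓗⁺` in the smooth class) — the bet is the global two-sided structure
(eternal `t`-independence on a horizon-penetrating chart) + AIK-type Carleman continuation, not local extension;
`KerrSuperradiance` / `KerrNoTimelikeKillingCombination`: the ergo-belt is where S1 is hard (no timelike Killing
combination covers it); `HairyKerrBifurcation` / `KerrLinearHair`: hairy stationary holes need matter or massive
fields — the class is vacuum. Sibling negative knowledge: EP item 10745 (`EternalStationaryExteriorIsKerr`) was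
refuted-MISSTATED through `docOfEnd (range Φ)` of a horizon-penetrating far chart; this crux has no `docOfEnd`:
the conclusion is an isometric embedding of the WHOLE cylinder into Kerr–Schild Kerr, collar included.
-/

set_option linter.dupNamespace false

namespace Summit.FinalStateConjecture.FinalStateConjecture.Cruxes.StationaryHarmonicExteriorIsKerr.Birth

open scoped BigOperators Topology Manifold Classical MeasureTheory ProbabilityTheory Matrix InnerProductSpace ComplexConjugate ContinuousMap
open Filter Set Function TopologicalSpace MeasureTheory

/-! ## The two registered stubs -/

/-- **Registered stub 1 — a second Killing field (Hawking rigidity without analyticity; HARDEST).** A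
`t`-independent member of X's class carries a smooth coordinate Killing field `K` on the cylinder, invariant under
the chart's time translation and not a constant multiple of `e₀`. -/
theorem stub_secondKilling :
    ∀ (a r₀ : ℝ) (G : Literature.Geometry.Lorentzian.E4 → Literature.Geometry.Lorentzian.E4 →L[ℝ] Literature.Geometry.Lorentzian.E4 →L[ℝ] ℝ), (0 < r₀ ∧ Literature.Geometry.Lorentzian.MetricCoord.IsMetricOn G (Literature.Geometry.Lorentzian.Kerr.region a r₀ : Set Literature.Geometry.Lorentzian.E4) ∧ (∃ c₀ δ : ℝ, 0 < c₀ ∧ 0 < δ ∧ ∀ x ∈ Literature.Geometry.Lorentzian.Kerr.region a r₀, (Literature.Geometry.Lorentzian.E4.dx 0) (Literature.Geometry.Lorentzian.MetricCoord.sharpAt G x (Literature.Geometry.Lorentzian.E4.dx 0)) ≤ -c₀ ∧ (Literature.Geometry.Lorentzian.Kerr.radius a x < r₀ + δ → (fderiv ℝ (Literature.Geometry.Lorentzian.Kerr.radius a) x) (Literature.Geometry.Lorentzian.MetricCoord.sharpAt G x (fderiv ℝ (Literature.Geometry.Lorentzian.Kerr.radius a) x)) ≤ -c₀ ∧ c₀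 ≤ (Literature.Geometry.Lorentzian.E4.dx 0) (Literature.Geometry.Lorentzian.MetricCoord.sharpAt G x (fderiv ℝ (Literature.Geometry.Lorentzian.Kerr.radius a) x)))) ∧ (∀ x ∈ Literature.Geometry.Lorentzian.Kerr.region a r₀, Literature.Geometry.Lorentzian.MetricCoord.ricAt G x = 0) ∧ (∀ x ∈ Literature.Geometry.Lorentzian.Kerr.region a r₀, ∑ β : Fin 4, Literature.Geometry.Lorentzian.MetricCoord.chrAt G x (Literature.Geometry.Lorentzian.MetricCoord.sharpAt G x (Literature.Geometry.Lorentzian.E4.dx β)) (Literature.Geometry.Lorentzian.E4.basisVector β) = 0) ∧ (∀ k : ℕ, ∃ C : ℝ, ∀ x ∈ Literature.Geometry.Lorentzian.Kerr.region a r₀, ‖iteratedFDeriv ℝ k G x‖ ≤ C ∧ ‖Literature.Geometry.Lorentzian.MetricCoord.sharpAt G x‖ ≤ C) ∧ (∃ C : ℝ, ∀ x ∈ Literature.Geometry.Lorentzian.Kerr.region a r₀, ‖G x - Literature.Geometry.Lorentzian.Minkowski.bilin‖ ≤ C / Literature.Geometry.Lorentzian.E4.spatialNorm x ∧ ‖iteratedFDeriv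 ℝ 1 G x‖ ≤ C / Literature.Geometry.Lorentzian.E4.spatialNorm x ^ 2 ∧ ‖iteratedFDeriv ℝ 2 G x‖ ≤ C / Literature.Geometry.Lorentzian.E4.spatialNorm x ^ 3)) → (∀ x ∈ Literature.Geometry.Lorentzian.Kerr.region a r₀, ∀ s : ℝ, G (x + s • Literature.Geometry.Lorentzian.E4.basisVector 0) = G x) → ∃ K : Literature.Geometry.Lorentzian.E4 → Literature.Geometry.Lorentzian.E4, ContDiffOn ℝ (⊤ : ℕ∞) K (Literature.Geometry.Lorentzian.Kerr.region a r₀ : Set Literature.Geometry.Lorentzian.E4) ∧ (∀ x ∈ Literature.Geometry.Lorentzian.Kerr.region a r₀, ∀ s : ℝ, K (x + s • Literature.Geometry.Lorentzian.E4.basisVector 0) = K x) ∧ (∀ x ∈ Literature.Geometry.Lorentzian.Kerr.region a r₀, ∀ v w : Literature.Geometry.Lorentzian.E4, fderiv ℝ G x (K x) v w + G x (fderiv ℝ K x v) w + G x v (fderiv ℝ K x w) = 0) ∧ ¬ (∃ c : ℝ, ∀ x ∈ Literature.Geometry.Lorentzian.Kerr.region a r₀, K x = c • Literature.Geometry.Lorentzian.E4.basisVector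 0) := by
  sorry

/-- **Registered stub 2 — axisymmetric uniqueness (Carter–Robinson–Mazur–Bunting–Weinstein + Chruściel–Costa /
Chruściel–Nguyen + Fuchsian continuation into the collar).** A `t`-independent member of X's class with such a
second Killing field is an isometrically embedded piece of an ingoing Kerr–Schild Kerr spacetime, `0 < M'`,
`|a'| ≤ M'`. -/
theorem stub_axisymmetricUniqueness :
    ∀ (a r₀ : ℝ) (G : Literature.Geometry.Lorentzian.E4 → Literature.Geometry.Lorentzian.E4 →L[ℝ] Literature.Geometry.Lorentzian.E4 →L[ℝ] ℝ), (0 < r₀ ∧ Literature.Geometry.Lorentzian.MetricCoord.IsMetricOn G (Literature.Geometry.Lorentzian.Kerr.region a r₀ : Set Literature.Geometry.Lorentzian.E4) ∧ (∃ c₀ δ : ℝ, 0 < c₀ ∧ 0 < δ ∧ ∀ x ∈ Literature.Geometry.Lorentzian.Kerr.region a r₀, (Literature.Geometry.Lorentzian.E4.dx 0) (Literature.Geometry.Lorentzian.MetricCoord.sharpAt G x (Literature.Geometry.Lorentzian.E4.dx 0)) ≤ -c₀ ∧ (Literature.Geometry.Lorentzian.Kerr.radius a x < r₀ + δ → (fderiv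 ℝ (Literature.Geometry.Lorentzian.Kerr.radius a) x) (Literature.Geometry.Lorentzian.MetricCoord.sharpAt G x (fderiv ℝ (Literature.Geometry.Lorentzian.Kerr.radius a) x)) ≤ -c₀ ∧ c₀ ≤ (Literature.Geometry.Lorentzian.E4.dx 0) (Literature.Geometry.Lorentzian.MetricCoord.sharpAt G x (fderiv ℝ (Literature.Geometry.Lorentzian.Kerr.radius a) x)))) ∧ (∀ x ∈ Literature.Geometry.Lorentzian.Kerr.region a r₀, Literature.Geometry.Lorentzian.MetricCoord.ricAt G x = 0) ∧ (∀ x ∈ Literature.Geometry.Lorentzian.Kerr.region a r₀, ∑ β : Fin 4, Literature.Geometry.Lorentzian.MetricCoord.chrAt G x (Literature.Geometry.Lorentzian.MetricCoord.sharpAt G x (Literature.Geometry.Lorentzian.E4.dx β)) (Literature.Geometry.Lorentzian.E4.basisVector β) = 0) ∧ (∀ k : ℕ, ∃ C : ℝ, ∀ x ∈ Literature.Geometry.Lorentzian.Kerr.region a r₀, ‖iteratedFDeriv ℝ k G x‖ ≤ C ∧ ‖Literature.Geometry.Lorentzian.MetricCoord.sharpAt G x‖ ≤ C) ∧ (∃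 C : ℝ, ∀ x ∈ Literature.Geometry.Lorentzian.Kerr.region a r₀, ‖G x - Literature.Geometry.Lorentzian.Minkowski.bilin‖ ≤ C / Literature.Geometry.Lorentzian.E4.spatialNorm x ∧ ‖iteratedFDeriv ℝ 1 G x‖ ≤ C / Literature.Geometry.Lorentzian.E4.spatialNorm x ^ 2 ∧ ‖iteratedFDeriv ℝ 2 G x‖ ≤ C / Literature.Geometry.Lorentzian.E4.spatialNorm x ^ 3)) → (∀ x ∈ Literature.Geometry.Lorentzian.Kerr.region a r₀, ∀ s : ℝ, G (x + s • Literature.Geometry.Lorentzian.E4.basisVector 0) = G x) → (∃ K : Literature.Geometry.Lorentzian.E4 → Literature.Geometry.Lorentzian.E4, ContDiffOn ℝ (⊤ : ℕ∞) K (Literature.Geometry.Lorentzian.Kerr.region a r₀ : Set Literature.Geometry.Lorentzian.E4) ∧ (∀ x ∈ Literature.Geometry.Lorentzian.Kerr.region a r₀, ∀ s : ℝ, K (x + s • Literature.Geometry.Lorentzian.E4.basisVector 0) = K x) ∧ (∀ x ∈ Literature.Geometry.Lorentzian.Kerr.region a r₀, ∀ v w : Literature.Geometry.Lorentzian.E4,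 fderiv ℝ G x (K x) v w + G x (fderiv ℝ K x v) w + G x v (fderiv ℝ K x w) = 0) ∧ ¬ (∃ c : ℝ, ∀ x ∈ Literature.Geometry.Lorentzian.Kerr.region a r₀, K x = c • Literature.Geometry.Lorentzian.E4.basisVector 0)) → ∃ (M' a' : ℝ) (Ψ : Literature.Geometry.Lorentzian.E4 → Literature.Geometry.Lorentzian.E4), 0 < M' ∧ |a'| ≤ M' ∧ ContDiffOn ℝ (⊤ : ℕ∞) Ψ (Literature.Geometry.Lorentzian.Kerr.region a r₀ : Set Literature.Geometry.Lorentzian.E4) ∧ Set.InjOn Ψ (Literature.Geometry.Lorentzian.Kerr.region a r₀ : Set Literature.Geometry.Lorentzian.E4) ∧ (∀ x ∈ Literature.Geometry.Lorentzian.Kerr.region a r₀, 0 < Literature.Geometry.Lorentzian.Kerr.radius a' (Ψ x)) ∧ ∀ x ∈ Literature.Geometry.Lorentzian.Kerr.region a r₀, ∀ v w : Literature.Geometry.Lorentzian.E4, G x v w = Literature.Geometry.Lorentzian.Kerr.bilin M' a' (Ψ x) (fderiv ℝ Ψ x v) (fderiv ℝ Ψ x w) := by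
  sorry

/-! ## Registered stub signatures (verbatim, as named `Prop`s) -/
namespace Sig

/-- Registered signature of `stub_secondKilling` (verbatim). -/
abbrev stub_secondKilling : Prop :=
  ∀ (a r₀ : ℝ) (G : Literature.Geometry.Lorentzian.E4 → Literature.Geometry.Lorentzian.E4 →L[ℝ] Literature.Geometry.Lorentzian.E4 →L[ℝ] ℝ), (0 < r₀ ∧ Literature.Geometry.Lorentzian.MetricCoord.IsMetricOn G (Literature.Geometry.Lorentzian.Kerr.region a r₀ : Set Literature.Geometry.Lorentzian.E4) ∧ (∃ c₀ δ : ℝ, 0 < c₀ ∧ 0 < δ ∧ ∀ x ∈ Literature.Geometry.Lorentzian.Kerr.region a r₀, (Literature.Geometry.Lorentzian.E4.dx 0) (Literature.Geometry.Lorentzian.MetricCoord.sharpAt G x (Literature.Geometry.Lorentzian.E4.dx 0)) ≤ -c₀ ∧ (Literature.Geometry.Lorentzian.Kerr.radius a x < r₀ + δ → (fderiv ℝ (Literature.Geometry.Lorentzian.Kerr.radius a) x) (Literature.Geometry.Lorentzian.MetricCoord.sharpAt G x (fderiv ℝ (Literature.Geometry.Lorentzian.Kerr.radius a) x)) ≤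 -c₀ ∧ c₀ ≤ (Literature.Geometry.Lorentzian.E4.dx 0) (Literature.Geometry.Lorentzian.MetricCoord.sharpAt G x (fderiv ℝ (Literature.Geometry.Lorentzian.Kerr.radius a) x)))) ∧ (∀ x ∈ Literature.Geometry.Lorentzian.Kerr.region a r₀, Literature.Geometry.Lorentzian.MetricCoord.ricAt G x = 0) ∧ (∀ x ∈ Literature.Geometry.Lorentzian.Kerr.region a r₀, ∑ β : Fin 4, Literature.Geometry.Lorentzian.MetricCoord.chrAt G x (Literature.Geometry.Lorentzian.MetricCoord.sharpAt G x (Literature.Geometry.Lorentzian.E4.dx β)) (Literature.Geometry.Lorentzian.E4.basisVector β) = 0) ∧ (∀ k : ℕ, ∃ C : ℝ, ∀ x ∈ Literature.Geometry.Lorentzian.Kerr.region a r₀, ‖iteratedFDeriv ℝ k G x‖ ≤ C ∧ ‖Literature.Geometry.Lorentzian.MetricCoord.sharpAt G x‖ ≤ C) ∧ (∃ C : ℝ, ∀ x ∈ Literature.Geometry.Lorentzian.Kerr.region a r₀, ‖G x - Literature.Geometry.Lorentzian.Minkowski.bilin‖ ≤ C / Literature.Geometry.Lorentzian.E4.spatialNorm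 x ∧ ‖iteratedFDeriv ℝ 1 G x‖ ≤ C / Literature.Geometry.Lorentzian.E4.spatialNorm x ^ 2 ∧ ‖iteratedFDeriv ℝ 2 G x‖ ≤ C / Literature.Geometry.Lorentzian.E4.spatialNorm x ^ 3)) → (∀ x ∈ Literature.Geometry.Lorentzian.Kerr.region a r₀, ∀ s : ℝ, G (x + s • Literature.Geometry.Lorentzian.E4.basisVector 0) = G x) → ∃ K : Literature.Geometry.Lorentzian.E4 → Literature.Geometry.Lorentzian.E4, ContDiffOn ℝ (⊤ : ℕ∞) K (Literature.Geometry.Lorentzian.Kerr.region a r₀ : Set Literature.Geometry.Lorentzian.E4) ∧ (∀ x ∈ Literature.Geometry.Lorentzian.Kerr.region a r₀, ∀ s : ℝ, K (x + s • Literature.Geometry.Lorentzian.E4.basisVector 0) = K x) ∧ (∀ x ∈ Literature.Geometry.Lorentzian.Kerr.region a r₀, ∀ v w : Literature.Geometry.Lorentzian.E4, fderiv ℝ G x (K x) v w + G x (fderiv ℝ K x v) w + G x v (fderiv ℝ K x w) = 0) ∧ ¬ (∃ c : ℝ, ∀ x ∈ Literature.Geometry.Lorentzian.Kerr.region a r₀,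 K x = c • Literature.Geometry.Lorentzian.E4.basisVector 0)

/-- Registered signature of `stub_axisymmetricUniqueness` (verbatim). -/
abbrev stub_axisymmetricUniqueness : Prop :=
  ∀ (a r₀ : ℝ) (G : Literature.Geometry.Lorentzian.E4 → Literature.Geometry.Lorentzian.E4 →L[ℝ] Literature.Geometry.Lorentzian.E4 →L[ℝ] ℝ), (0 < r₀ ∧ Literature.Geometry.Lorentzian.MetricCoord.IsMetricOn G (Literature.Geometry.Lorentzian.Kerr.region a r₀ : Set Literature.Geometry.Lorentzian.E4) ∧ (∃ c₀ δ : ℝ, 0 < c₀ ∧ 0 < δ ∧ ∀ x ∈ Literature.Geometry.Lorentzian.Kerr.region a r₀, (Literature.Geometry.Lorentzian.E4.dx 0) (Literature.Geometry.Lorentzian.MetricCoord.sharpAt G x (Literature.Geometry.Lorentzian.E4.dx 0)) ≤ -c₀ ∧ (Literature.Geometry.Lorentzian.Kerr.radius a x < r₀ + δ → (fderiv ℝ (Literature.Geometry.Lorentzian.Kerr.radius a) x) (Literature.Geometry.Lorentzian.MetricCoord.sharpAt G x (fderiv ℝ (Literature.Geometry.Lorentzian.Kerr.radius a) x)) ≤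 -c₀ ∧ c₀ ≤ (Literature.Geometry.Lorentzian.E4.dx 0) (Literature.Geometry.Lorentzian.MetricCoord.sharpAt G x (fderiv ℝ (Literature.Geometry.Lorentzian.Kerr.radius a) x)))) ∧ (∀ x ∈ Literature.Geometry.Lorentzian.Kerr.region a r₀, Literature.Geometry.Lorentzian.MetricCoord.ricAt G x = 0) ∧ (∀ x ∈ Literature.Geometry.Lorentzian.Kerr.region a r₀, ∑ β : Fin 4, Literature.Geometry.Lorentzian.MetricCoord.chrAt G x (Literature.Geometry.Lorentzian.MetricCoord.sharpAt G x (Literature.Geometry.Lorentzian.E4.dx β)) (Literature.Geometry.Lorentzian.E4.basisVector β) = 0) ∧ (∀ k : ℕ, ∃ C : ℝ, ∀ x ∈ Literature.Geometry.Lorentzian.Kerr.region a r₀, ‖iteratedFDeriv ℝ k G x‖ ≤ C ∧ ‖Literature.Geometry.Lorentzian.MetricCoord.sharpAt G x‖ ≤ C) ∧ (∃ C : ℝ, ∀ x ∈ Literature.Geometry.Lorentzian.Kerr.region a r₀, ‖G x - Literature.Geometry.Lorentzian.Minkowski.bilin‖ ≤ C / Literature.Geometry.Lorentzian.E4.spatialNorm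 x ∧ ‖iteratedFDeriv ℝ 1 G x‖ ≤ C / Literature.Geometry.Lorentzian.E4.spatialNorm x ^ 2 ∧ ‖iteratedFDeriv ℝ 2 G x‖ ≤ C / Literature.Geometry.Lorentzian.E4.spatialNorm x ^ 3)) → (∀ x ∈ Literature.Geometry.Lorentzian.Kerr.region a r₀, ∀ s : ℝ, G (x + s • Literature.Geometry.Lorentzian.E4.basisVector 0) = G x) → (∃ K : Literature.Geometry.Lorentzian.E4 → Literature.Geometry.Lorentzian.E4, ContDiffOn ℝ (⊤ : ℕ∞) K (Literature.Geometry.Lorentzian.Kerr.region a r₀ : Set Literature.Geometry.Lorentzian.E4) ∧ (∀ x ∈ Literature.Geometry.Lorentzian.Kerr.region a r₀, ∀ s : ℝ, K (x + s • Literature.Geometry.Lorentzian.E4.basisVector 0) = K x) ∧ (∀ x ∈ Literature.Geometry.Lorentzian.Kerr.region a r₀, ∀ v w : Literature.Geometry.Lorentzian.E4, fderiv ℝ G x (K x) v w + G x (fderiv ℝ K x v) w + G x v (fderiv ℝ K x w) = 0) ∧ ¬ (∃ c : ℝ, ∀ x ∈ Literature.Geometry.Lorentzian.Kerr.region a r₀,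 K x = c • Literature.Geometry.Lorentzian.E4.basisVector 0)) → ∃ (M' a' : ℝ) (Ψ : Literature.Geometry.Lorentzian.E4 → Literature.Geometry.Lorentzian.E4), 0 < M' ∧ |a'| ≤ M' ∧ ContDiffOn ℝ (⊤ : ℕ∞) Ψ (Literature.Geometry.Lorentzian.Kerr.region a r₀ : Set Literature.Geometry.Lorentzian.E4) ∧ Set.InjOn Ψ (Literature.Geometry.Lorentzian.Kerr.region a r₀ : Set Literature.Geometry.Lorentzian.E4) ∧ (∀ x ∈ Literature.Geometry.Lorentzian.Kerr.region a r₀, 0 < Literature.Geometry.Lorentzian.Kerr.radius a' (Ψ x)) ∧ ∀ x ∈ Literature.Geometry.Lorentzian.Kerr.region a r₀, ∀ v w : Literature.Geometry.Lorentzian.E4, G x v w = Literature.Geometry.Lorentzian.Kerr.bilin M' a' (Ψ x) (fderiv ℝ Ψ x v) (fderiv ℝ Ψ x w)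

end Sig

/-- The registered signatures ARE the statements of the two `stub_*` theorems (ascription; no `sorry` of their own). -/
example : Sig.stub_secondKilling := stub_secondKilling
example : Sig.stub_axisymmetricUniqueness := stub_axisymmetricUniqueness

/-! ## The composition: the crux BY NAME from the two stub statements (no `sorry`) -/

/-- **`StationaryHarmonicExteriorIsKerr` from the two stubs.** Chain the second Killing field of stub 1 into the
axisymmetric uniqueness of stub 2. -/
theorem StationaryHarmonicExteriorIsKerr_of
    (h₁ : Sig.stub_secondKilling) (h₂ : Sig.stub_axisymmetricUniqueness) :
    Summit.FinalStateConjecture.FinalStateConjecture.Theses.TemporalBandLiouville.StationaryHarmonicExteriorIsKerr := by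
  intro a r₀ G hG hstat
  exact h₂ a r₀ G hG hstat (h₁ a r₀ G hG hstat)

end Summit.FinalStateConjecture.FinalStateConjecture.Cruxes.StationaryHarmonicExteriorIsKerr.Birth
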